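import Literature.NumberTheory.ComplexMultiplication.EllipticUnits.ImaginaryQuadraticMainConjectureCarriersOCoresTransitive
import Summits.BirchSwinnertonDyer.BirchSwinnertonDyer.Theorems.SignedLowerHalvesSmallImageLowerHalfBothSignsRttD2J2Specialisation
import Summits.BirchSwinnertonDyer.BirchSwinnertonDyer.Theorems.SignedLowerHalvesSmallImageLowerHalfBothSignsRttD2J2Levelwise
import HarnessLib

/-!
# Route `SignedLowerHalves`, crux L `SmallImageLowerHalfBothSigns` (stmt-BirchSwinnertonDyer-23599), line `rtt_w3` v28 — row **S3α** (`stub_junctionSha_ns`), brick **α1**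
# (the specialisation `sp²` in DEGREE 2), MAP HALF: `sp² : 𝐇²(𝒪_K[1/p𝔣], Λ_{𝒪,2}(θ)(1)) → 𝐇²_{supp(p𝔣)}(K^{(1)}_∞/K, 𝒪(θ)(1))` EXISTS, is `Λ_𝒪`-semilinear and kills `T₂`

INPUTS hand `bsd-inputs-honda-p1` g27 under LEAD `cruxlead-stmt-BirchSwinnertonDyer-23599` g13 (DESIGN `Lines/rtt_w3-DESIGN-S3alpha-lead-g13.md`, brick α1 «∃ e :
QuotSMulTop (C (X − C 0)) D₂'.H →ₗ[Λ_𝒪] I₂.H, Injective e»; LEAD ask 2026-08-31T05:35Z to the honda lineage). Helper `--supports stmt-BirchSwinnertonDyer-23599`. THEOREMS ONLY.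
The degree-`2` twin of honda g23's `…RttD2J2Corestriction` §2 (degree `1`): the ONE new input is the transitivity of the level corestrictions in degree `2`
(`relCoresO_relCoresO`, all degrees, `…CarriersOCoresTransitive.lean` ⟸ `relCor_relCor`, `GaloisRepresentations/RelativeCorestrictionTransitive.lean`), which makes the
corestricted family `(cor_{K̃_n/K^{(1)}_n} (proj n k x))_{n,k}` of a two-variable degree-`2` class compatible with the `κ₁`-tower (`spLevel_layerCoresO`, now every degree).
* §1 `spLevel_layerCoresO` (all degrees `i`).
* §3 ★★ `coresHom₂_smul` (`sp² (F • x) = φ₀ F • sp² x`, every `F`), ★★★ `exists_specialisationLinearMap₂(_frame_zero)` — the brick's `e : QuotSMulTop (C (X − C 0)) 𝐇²₂ →ₗ[Λ_𝒪] 𝐇²_cyc`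
  with `e [x] = sp² x`, for any `Λ_𝒪`-structure pinned by the frame's `hιH`.
* §2 ★★ `exists_coresHom₂` (`sp²` pinned levelwise, from (P4)/(P3) of `I₂`), `coresHom₂_unique`, `proj_coresHom₂_C_X_smul` (the `T₂`-clause;
  with `γ₂ ∈ ker κ₁`, `sp²` kills `T₂·𝐇²₂` and factors through `𝐇²₂ ⧸ T₂ = QuotSMulTop (C (X − C 0)) D₂'.H` — inlined in §3; the `T₁`/constants clauses are the cases
  `F = X`, `F = C (C c)` of §3's `coresHom₂_smul`).
WHAT REMAINS of α1 (the research half, NOT here): INJECTIVITY of the induced `e : 𝐇²₂/T₂ → 𝐇²_cyc`, i.e. `ker sp² ⊆ T₂·𝐇²₂` — the middle exactness of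
`𝐇²(Λ₂) →T₂→ 𝐇²(Λ₂) →sp²→ 𝐇²(Λ_cyc)` passed to honda's levelwise currency (NO `cd_p ≤ 2` input is needed for injectivity; `H³ = 0` would only give surjectivity).
HONEST FRAMING: S3α, S3β, S4′, E2, crux L, crux M and BSD remain OPEN; BSD is proved for NO curve.

References: [NeukirchSchmidtWingberg2008] I §5 Prop. 1.5.2–1.5.4; [JohnsonLeungKings2011] §4.2 Def. 4.2 (94) (arXiv p0012:L80–112); [Kato2004Asterisque] §8.2 (p. 180), §12.2 (12.2.1);
[SerreLocalFields1979] VII §5 Prop. 3; [PerrinRiou1994Invent] §1.3.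
-/

set_option autoImplicit false
-- the Theorems namespace of this sub repeats the summit name by design (D-0017 nested layout)
set_option linter.dupNamespace false

noncomputable section

namespace Summit.BirchSwinnertonDyer.BirchSwinnertonDyer.Theorems.SmallImageRttJunctionSha

open scoped NumberField PowerSeries Pointwise
open CategoryTheory Field IsDedekindDomain
open Literature.NumberTheory.GaloisRepresentations
open Literature.NumberTheory.EllipticCurves
open Literature.NumberTheory.ComplexMultiplication.EllipticUnits
open Literature.NumberTheory.ComplexMultiplication.EllipticUnits.JohnsonLeungKings2011
open Summit.BirchSwinnertonDyer.BirchSwinnertonDyer.Theorems.SmallImageRttD2J1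
open Summit.BirchSwinnertonDyer.BirchSwinnertonDyer.Theorems.SmallImageRttD2J2

/-! ## §1 The levelwise corestriction in degree `2` is compatible with the corestrictions in `n` -/

section Level

variable {K : Type} [Field K] [NumberField K] {p : ℕ} [Fact p.Prime] (S : Set (PadicAlgCl p))
  (κ₁ κ₂ : ZpExtension K p) (θ : absoluteGaloisGroup K →ₜ* (padicCoeffIntegers S)ˣ) (𝔣 : Ideal (𝓞 K))

/-- **Compatibility with the corestrictions in `n`, EVERY degree**: `cor_{K̃_n/K^{(1)}_n} ∘ cor_{K̃_{n+1}/K̃_n} = cor_{K^{(1)}_{n+1}/K^{(1)}_n} ∘ cor_{K̃_{n+1}/K^{(1)}_{n+1}}`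
(both are `cor_{K̃_{n+1}/K^{(1)}_n}`: transitivity `relCoresO_relCoresO`, now available in all degrees). [cite: NeukirchSchmidtWingberg2008, I §5 Prop. 1.5.3 (iii)] -/
theorem spLevel_layerCoresO (n k i : ℕ) (y : layerCohO S κ₁ κ₂ θ 𝔣 (n + 1) k i) :
    spLevel S κ₁ κ₂ θ 𝔣 n k i (layerCoresO S κ₁ κ₂ θ 𝔣 n k i y) =
      cycLayerCoresO S κ₁ θ (suppPF p 𝔣) n k i (spLevel S κ₁ κ₂ θ 𝔣 (n + 1) k i y) := by
  rw [spLevel, layerCoresO, relCoresO_relCoresO, spLevel, cycLayerCoresO, relCoresO_relCoresO]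

end Level

/-! ## §2 The corestriction on the pinned data in degree `2` (the map half of sp²) -/

section Data

variable {K : Type} [Field K] [NumberField K] {p : ℕ} [Fact p.Prime] {S : Set (PadicAlgCl p)}
  {κ₁ κ₂ : ZpExtension K p} {γ₁ γ₂ : absoluteGaloisGroup K} {θ : absoluteGaloisGroup K →ₜ* (padicCoeffIntegers S)ˣ} {𝔣 : Ideal (𝓞 K)}
  (D₂ : IwasawaCohomologyDataO S κ₁ κ₂ γ₁ γ₂ θ 𝔣 2) (D₁ : CycIwasawaCohomologyDataO S κ₁ γ₁ θ (suppPF p 𝔣) 2)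

/-- **The corestricted family of a two-variable degree-`2` class is compatible** with the `κ₁`-tower's cores and reductions.
[cite: NeukirchSchmidtWingberg2008, I §5 Prop. 1.5.2–1.5.3] -/
theorem spLevel_proj_compatible₂ (x : D₂.H) :
    (∀ n k, cycLayerCoresO S κ₁ θ (suppPF p 𝔣) n k 2 (spLevel S κ₁ κ₂ θ 𝔣 (n + 1) k 2 (D₂.proj (n + 1) k x)) = spLevel S κ₁ κ₂ θ 𝔣 n k 2 (D₂.proj n k x)) ∧
      ∀ n k, cycLayerRedO S κ₁ θ (suppPF p 𝔣) n k 2 (spLevel S κ₁ κ₂ θ 𝔣 n (k + 1) 2 (D₂.proj n (k + 1) x)) = spLevel S κ₁ κ₂ θ 𝔣 n k 2 (D₂.proj n k x) :=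
  ⟨fun n k ↦ by rw [← spLevel_layerCoresO, D₂.proj_cores], fun n k ↦ by rw [← spLevel_layerRedO, D₂.proj_red]⟩

/-- ★★ **The corestriction `sp² : 𝐇²(𝒪_K[1/p𝔣], Λ_{𝒪,2}(θ)(1)) → 𝐇²_{supp(p𝔣)}(K^{(1)}_∞/K, 𝒪(θ)(1))` EXISTS on the pinned degree-`2` data**, pinned levelwise by
`D₁.proj n k (res x) = cor_{K̃_n/K^{(1)}_n} (D₂.proj n k x)` — the degree-`2` twin of `SmallImageRttD2J2.exists_coresHom` (row S3α brick α1, map half).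
[cite: NeukirchSchmidtWingberg2008, I §5 Prop. 1.5.2–1.5.4] [cite: Kato2004Asterisque, §12.2 (12.2.1) (p. 220)] -/
theorem exists_coresHom₂ : ∃ res : D₂.H →+ D₁.H, ∀ (n k : ℕ) (x : D₂.H), D₁.proj n k (res x) = spLevel S κ₁ κ₂ θ 𝔣 n k 2 (D₂.proj n k x) := by
  choose r hr using fun x : D₂.H ↦
    D₁.proj_surjective (fun n k ↦ spLevel S κ₁ κ₂ θ 𝔣 n k 2 (D₂.proj n k x)) (spLevel_proj_compatible₂ D₂ x).1 (spLevel_proj_compatible₂ D₂ x).2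
  refine ⟨{ toFun := r, map_zero' := ?_, map_add' := fun x y ↦ ?_ }, fun n k x ↦ hr x n k⟩
  · exact D₁.proj_injective _ fun n k ↦ by rw [hr, map_zero, map_zero]
  · refine sub_eq_zero.mp (D₁.proj_injective _ fun n k ↦ ?_)
    rw [map_sub, map_add, hr, hr, hr, map_add, map_add, sub_self]

/-- **Uniqueness**: the levelwise pin determines `sp²` ((P3) of `D₁`). [cite: Kato2004Asterisque, §8.2 (p. 180)] -/
theorem coresHom₂_unique {res res' : D₂.H →+ D₁.H} (h : ∀ n k x, D₁.proj n k (res x) = spLevel S κ₁ κ₂ θ 𝔣 n k 2 (D₂.proj n k x))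
    (h' : ∀ n k x, D₁.proj n k (res' x) = spLevel S κ₁ κ₂ θ 𝔣 n k 2 (D₂.proj n k x)) : res = res' := by
  ext x
  refine sub_eq_zero.mp (D₁.proj_injective _ fun n k ↦ ?_)
  rw [map_sub, h, h', sub_self]

variable {D₂ D₁} {res : D₂.H →+ D₁.H} (hres : ∀ (n k : ℕ) (x : D₂.H), D₁.proj n k (res x) = spLevel S κ₁ κ₂ θ 𝔣 n k 2 (D₂.proj n k x))
include hres

/-- ★ **The `T₂`-clause**: `D₁.proj n k (sp² (C X • x)) = conj_{γ₂} (D₁.proj n k (sp² x)) − D₁.proj n k (sp² x)` (the inner variable `T₂ = conj_{γ₂} − 1` goes to the conjugation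
by `γ₂` on the levels of the `κ₁`-line). [cite: NeukirchSchmidtWingberg2008, I §5 Prop. 1.5.4] -/
theorem proj_coresHom₂_C_X_smul (n k : ℕ) (x : D₂.H) :
    D₁.proj n k (res ((PowerSeries.C (PowerSeries.X : PowerSeries (padicCoeffIntegers S)) : IwasawaAlgebraO₂ S) • x)) =
      cycLayerConjO S κ₁ θ (suppPF p 𝔣) n k 2 γ₂ (D₁.proj n k (res x)) - D₁.proj n k (res x) := by
  rw [hres, D₂.proj_T₂_smul, hres, map_sub, spLevel_layerConjO]

end Data

/-! ## §3 `sp²` is `Λ`-semilinear along `φ₀`; the untwisted specialisation `e : 𝐇²₂ ⧸ f•𝐇²₂ →ₗ[Λ_𝒪] 𝐇²_cyc` (degree-`2` twin of `SmallImageRttD2J2` §2) -/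

section Specialisation

variable {K : Type} [Field K] [NumberField K] {p : ℕ} [Fact p.Prime] {S : Set (PadicAlgCl p)}
  {κ₁ κ₂ : ZpExtension K p} {γ₁ γ₂ : absoluteGaloisGroup K} {θ : absoluteGaloisGroup K →ₜ* (padicCoeffIntegers S)ˣ} {𝔣 : Ideal (𝓞 K)}
  {D₂ : IwasawaCohomologyDataO S κ₁ κ₂ γ₁ γ₂ θ 𝔣 2} {D₁ : CycIwasawaCohomologyDataO S κ₁ γ₁ θ (suppPF p 𝔣) 2}
  {res : D₂.H →+ D₁.H} (hres : ∀ (n k : ℕ) (x : D₂.H), D₁.proj n k (res x) = spLevel S κ₁ κ₂ θ 𝔣 n k 2 (D₂.proj n k x))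
  (hγ₂ : γ₂ ∈ κ₁.kerSubgroup)
include hres hγ₂

/-- ★★ **`sp² (F • x) = φ₀ F • sp² x` for EVERY `F ∈ Λ_{𝒪,2}`** (dual basis: `γ₂ ∈ Gal(K̄/K^{(1)}_∞)`): levelwise by `spLevel_smul` (`i = 2`) and the rigidity of the pins on
both data (`proj_smul_eq_layer_smul`, `proj_smul_eq_cycLayer_smul`, `i ≤ 2`), then (P3) of `D₁`. [cite: Kaplansky1954, §19 statement (a) (PDF p. 76)]
[cite: NeukirchSchmidtWingberg2008, I §5 Prop. 1.5.2–1.5.4] -/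
theorem coresHom₂_smul (F : IwasawaAlgebraO₂ S) (x : D₂.H) : res (F • x) = phi0 S F • res x := by
  refine sub_eq_zero.mp (D₁.proj_injective _ fun n k ↦ ?_)
  rw [map_sub, hres, proj_smul_eq_layer_smul le_rfl D₂ n k, spLevel_smul S κ₁ κ₂ γ₁ γ₂ θ 𝔣 le_rfl n k (κ₁.kerSubgroup_le_layerSubgroup n hγ₂),
    proj_smul_eq_cycLayer_smul le_rfl D₁ n k, hres, sub_self]

/-- ★★★ **THE UNTWISTED SPECIALISATION IN DEGREE 2, `e : 𝐇²₂ ⧸ f•𝐇²₂ →ₗ[Λ_𝒪] 𝐇²_cyc`**: for any `f ∈ Λ_{𝒪,2}` killed by `sp²` and ANY `Λ_𝒪`-structure on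
`QuotSMulTop f 𝐇²₂` pinned by the frame's `hιH : l • x = (map C l) • x`, a `Λ_𝒪`-LINEAR `e` with `e [x] = sp² x` — the map of the S3α brick α1.
[cite: JohnsonLeungKings2011, Cor. 5.3 (arXiv p0015:L1–20)] [cite: NeukirchSchmidtWingberg2008, I §5 Prop. 1.5.4] -/
theorem exists_specialisationLinearMap₂ (f : IwasawaAlgebraO₂ S) (hf : ∀ x : D₂.H, res (f • x) = 0)
    [Module (IwasawaAlgebraO S) (QuotSMulTop f D₂.H)]
    (hιH : ∀ (l : IwasawaAlgebraO S) (x : QuotSMulTop f D₂.H),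
      l • x = (PowerSeries.map (PowerSeries.C : padicCoeffIntegers S →+* PowerSeries (padicCoeffIntegers S)) l : IwasawaAlgebraO₂ S) • x) :
    ∃ e : QuotSMulTop f D₂.H →ₗ[IwasawaAlgebraO S] D₁.H, ∀ x : D₂.H, e (Submodule.Quotient.mk x) = res x := by
  have hvan : ∀ y ∈ (f • (⊤ : Submodule (IwasawaAlgebraO₂ S) D₂.H)).toAddSubgroup, res y = 0 := by
    intro y hy
    obtain ⟨m, -, rfl⟩ := (Submodule.mem_smul_pointwise_iff_exists y f ⊤).mp hy
    exact hf m
  refine ⟨{ toFun := QuotientAddGroup.lift _ res hvan, map_add' := fun x y ↦ map_add _ x y, map_smul' := fun l x ↦ ?_ }, fun x ↦ rfl⟩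
  obtain ⟨x, rfl⟩ := Submodule.Quotient.mk_surjective _ x
  rw [hιH, ← Submodule.Quotient.mk_smul]
  change res ((PowerSeries.map (PowerSeries.C : padicCoeffIntegers S →+* PowerSeries (padicCoeffIntegers S)) l : IwasawaAlgebraO₂ S) • x) = l • res x
  rw [coresHom₂_smul hres hγ₂, phi0_map_C]

/-- ★★★ **The S3α brick α1 map in the frame's currency**: `∃ e : QuotSMulTop (C (X − C 0)) 𝐇²₂ →ₗ[Λ_𝒪] 𝐇²_cyc` with `e [x] = sp² x`, for ANY `Λ_𝒪`-structure pinned by `hιH`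
(e.g. the frame's `Module.compHom _ (map C)`, for which `hιH` is `fun _ _ ↦ rfl`). What remains of α1: `Function.Injective e` (`ker sp² ⊆ T₂ • 𝐇²₂`).
[cite: JohnsonLeungKings2011, Cor. 5.3 (arXiv p0015:L1–20)] [cite: PerrinRiou1994Invent, §1.3] -/
theorem exists_specialisationLinearMap₂_frame_zero
    [Module (IwasawaAlgebraO S) (QuotSMulTop ((PowerSeries.C (PowerSeries.X - PowerSeries.C (0 : padicCoeffIntegers S)) : IwasawaAlgebraO₂ S)) D₂.H)]
    (hιH : ∀ (l : IwasawaAlgebraO S) (x : QuotSMulTop ((PowerSeries.C (PowerSeries.X - PowerSeries.C (0 : padicCoeffIntegers S)) : IwasawaAlgebraO₂ S)) D₂.H),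
      l • x = (PowerSeries.map (PowerSeries.C : padicCoeffIntegers S →+* PowerSeries (padicCoeffIntegers S)) l : IwasawaAlgebraO₂ S) • x) :
    ∃ e : QuotSMulTop ((PowerSeries.C (PowerSeries.X - PowerSeries.C (0 : padicCoeffIntegers S)) : IwasawaAlgebraO₂ S)) D₂.H →ₗ[IwasawaAlgebraO S] D₁.H,
      ∀ x : D₂.H, e (Submodule.Quotient.mk x) = res x :=
  exists_specialisationLinearMap₂ hres hγ₂ _ (fun x ↦ D₁.proj_injective _ fun n k ↦ by
    rw [map_zero, sub_zero, proj_coresHom₂_C_X_smul hres, cycLayerConjO,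
      levelConjO_eq_self_of_mem S (suppPF p 𝔣) θ (κ₁.kerSubgroup_le_layerSubgroup n hγ₂) (κ₁.isOpen_layerSubgroup n) k le_rfl, sub_self]) hιH

end Specialisation

end Summit.BirchSwinnertonDyer.BirchSwinnertonDyer.Theorems.SmallImageRttJunctionSha

end
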